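import Mathlib

/-!
# Padding a pattern face of `DS_N` into `DS_{N'}` (support of `DivisionGap.ShadowBirkhoff`)

Support file for item `stmt-ValiantsHypothesis-5069` (route `DivisionGap`, crux `ShadowBirkhoff`,
line `parabola-register-face`): the padding step `stub_facePad` of the line's skeleton.

A 0/1 pattern `G ⊆ [N]²` with two weight tables `wb wa : [N] → [N] → ℝ` reappears inside `[N']²`
for every `N' ≥ N` with the same SET of value pairs `(∑ u, wb u (ρ u), ∑ u, wa u (ρ u))` over the
permutations `ρ` supported in the pattern (`∀ u, (u, ρ u) ∈ G`, i.e. over the vertices of the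
face of the Birkhoff polytope `DS_N` cut out by `G`).

Construction (elementary bookkeeping): embed `[N] ↪ [N']` by `Fin.castLE`, let the padded pattern
be the image of `G` together with the diagonal cells `(v, v)`, `v ≥ N`, and extend both weight
tables by `0`.  A permutation of `[N']` supported in the padded pattern fixes every `v ≥ N`, hence
restricts (`Equiv.Perm.subtypePerm`, transported along `Fin.castLEquiv`) to a permutation of `[N]`
supported in `G` with the same value pair; conversely a permutation of `[N]` supported in `G`
extends by the identity (`Equiv.Perm.extendDomain`).  The sums are transferred by
`Fintype.sum_of_injective`.

Only Mathlib is used; nothing here refers to the Birkhoff-polytope API of the tree, and no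
statement of the Theses file is restated.
-/

noncomputable section

open scoped BigOperators

-- `Summit.<Summit>.<Problem>` repeats `ValiantsHypothesis` by the tree's layout convention.
set_option linter.dupNamespace false

namespace Summit.ValiantsHypothesis.ValiantsHypothesis.Theorems.DivisionGapShadowBirkhoff

open Equiv

/-- Sum transfer along the padding: if `w'` agrees with `w` on the initial segment (both
arguments below `N`, via `Fin.castLE h`) and vanishes whenever its first argument is `≥ N`, and
the permutation `ρ'` of `[N']` acts as `ρ` on the initial segment, then
`∑ v, w' v (ρ' v) = ∑ u, w u (ρ u)`. -/
theorem sum_pad_eq {N N' : ℕ} (h : N ≤ N') (w : Fin N → Fin N → ℝ)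
    (w' : Fin N' → Fin N' → ℝ)
    (hw : ∀ u u', w' (Fin.castLE h u) (Fin.castLE h u') = w u u')
    (hw0 : ∀ v v' : Fin N', ¬ (v : ℕ) < N → w' v v' = 0)
    (ρ : Perm (Fin N)) (ρ' : Perm (Fin N'))
    (hρ : ∀ u, ρ' (Fin.castLE h u) = Fin.castLE h (ρ u)) :
    ∑ v, w' v (ρ' v) = ∑ u, w u (ρ u) := by
  symm
  refine Fintype.sum_of_injective (Fin.castLE h) (Fin.castLE_injective h)
    (fun u => w u (ρ u)) (fun v => w' v (ρ' v)) ?_ ?_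
  · intro v hv
    exact hw0 v _ fun hvN => hv ⟨⟨v, hvN⟩, Fin.ext rfl⟩
  · intro u
    simp only [hρ, hw]

/-- On the initial segment the zero extension of a weight table `w : [N] → [N] → ℝ` to
`[N'] → [N'] → ℝ` returns `w`. -/
theorem pad_castLE {N N' : ℕ} (h : N ≤ N') (w : Fin N → Fin N → ℝ) (u u' : Fin N) :
    (fun v v' : Fin N' =>
        if hv : (v : ℕ) < N ∧ (v' : ℕ) < N then w ⟨v, hv.1⟩ ⟨v', hv.2⟩ else 0)
      (Fin.castLE h u) (Fin.castLE h u') = w u u' := by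
  simp

/-- The zero extension of a weight table vanishes as soon as its first argument is `≥ N`. -/
theorem pad_of_not_lt {N N' : ℕ} (w : Fin N → Fin N → ℝ) (v v' : Fin N')
    (hv : ¬ (v : ℕ) < N) :
    (fun v v' : Fin N' =>
        if hv : (v : ℕ) < N ∧ (v' : ℕ) < N then w ⟨v, hv.1⟩ ⟨v', hv.2⟩ else 0) v v' = 0 := by
  simp [hv]

/-- **Padding with abstract weights.**  For the padded pattern
`(Fin.castLE h × Fin.castLE h) '' G ∪ {(v, v) : v ≥ N}` and any weight tables `wb' wa'` on `[N']`
that agree with `wb wa` on the initial segment and vanish when the first argument is `≥ N`, the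
set of value pairs over the permutations of `[N']` supported in the padded pattern equals the set
of value pairs over the permutations of `[N]` supported in `G`. -/
theorem facePad_valueSet_eq {N N' : ℕ} (h : N ≤ N') (G : Finset (Fin N × Fin N))
    (wb wa : Fin N → Fin N → ℝ) (wb' wa' : Fin N' → Fin N' → ℝ)
    (hb : ∀ u u', wb' (Fin.castLE h u) (Fin.castLE h u') = wb u u')
    (hb0 : ∀ v v' : Fin N', ¬ (v : ℕ) < N → wb' v v' = 0)
    (ha : ∀ u u', wa' (Fin.castLE h u) (Fin.castLE h u') = wa u u')
    (ha0 : ∀ v v' : Fin N', ¬ (v : ℕ) < N → wa' v v' = 0) :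
    {p : ℝ × ℝ | ∃ ρ' : Equiv.Perm (Fin N'),
        (∀ u, (u, ρ' u) ∈ G.map ((Fin.castLEEmb h).prodMap (Fin.castLEEmb h)) ∪
            Finset.univ.filter (fun q : Fin N' × Fin N' => q.2 = q.1 ∧ N ≤ (q.1 : ℕ))) ∧
          (∑ u, wb' u (ρ' u), ∑ u, wa' u (ρ' u)) = p} =
      {p : ℝ × ℝ | ∃ ρ : Equiv.Perm (Fin N), (∀ u, (u, ρ u) ∈ G) ∧
        (∑ u, wb u (ρ u), ∑ u, wa u (ρ u)) = p} := by
  set G' := G.map ((Fin.castLEEmb h).prodMap (Fin.castLEEmb h)) ∪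
    Finset.univ.filter (fun q : Fin N' × Fin N' => q.2 = q.1 ∧ N ≤ (q.1 : ℕ)) with hG'
  -- membership in the padded pattern
  have mem_iff : ∀ v v' : Fin N', (v, v') ∈ G' ↔
      (∃ u u', (u, u') ∈ G ∧ Fin.castLE h u = v ∧ Fin.castLE h u' = v') ∨
        (v' = v ∧ N ≤ (v : ℕ)) := by
    intro v v'
    rw [hG']
    simp [Finset.mem_union, Finset.mem_map, Finset.mem_filter, Prod.exists]
  -- consequences of the membership characterisation
  have memG_of_mem : ∀ u u', (Fin.castLE h u, Fin.castLE h u') ∈ G' → (u, u') ∈ G := by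
    intro u u' hmem
    rcases (mem_iff _ _).1 hmem with ⟨u₁, u₁', hG, hu, hu'⟩ | ⟨-, hle⟩
    · obtain rfl := Fin.castLE_injective h hu
      obtain rfl := Fin.castLE_injective h hu'
      exact hG
    · exact absurd u.2 (not_lt.2 (by simpa using hle))
  have mem_of_memG : ∀ u u', (u, u') ∈ G → (Fin.castLE h u, Fin.castLE h u') ∈ G' :=
    fun u u' hG => (mem_iff _ _).2 (Or.inl ⟨u, u', hG, rfl, rfl⟩)
  have diag_mem : ∀ v : Fin N', ¬ (v : ℕ) < N → (v, v) ∈ G' :=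
    fun v hv => (mem_iff _ _).2 (Or.inr ⟨rfl, not_lt.1 hv⟩)
  have eq_of_mem : ∀ v v' : Fin N', (v, v') ∈ G' → ¬ (v : ℕ) < N → v' = v := by
    intro v v' hmem hv
    rcases (mem_iff _ _).1 hmem with ⟨u, u', -, hu, -⟩ | ⟨hvv, -⟩
    · exact absurd (show (v : ℕ) < N by rw [← hu]; exact u.2) hv
    · exact hvv
  have lt_of_mem : ∀ v v' : Fin N', (v, v') ∈ G' → (v : ℕ) < N → (v' : ℕ) < N := by
    intro v v' hmem hv
    rcases (mem_iff _ _).1 hmem with ⟨u, u', -, -, hu'⟩ | ⟨-, hle⟩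
    · rw [← hu']
      exact u'.2
    · exact absurd hv (not_lt.2 hle)
  ext p
  constructor
  · -- restriction: a permutation of `[N']` supported in `G'` restricts to `[N]`
    rintro ⟨ρ', hρ', hp⟩
    have hiff : ∀ v : Fin N', ((ρ' v : Fin N') : ℕ) < N ↔ (v : ℕ) < N := by
      intro v
      refine ⟨fun hlt => ?_, fun hv => lt_of_mem v (ρ' v) (hρ' v) hv⟩
      by_contra hv
      rw [eq_of_mem v (ρ' v) (hρ' v) hv] at hlt
      exact hv hlt
    set ρ : Perm (Fin N) := (Fin.castLEquiv h).symm.permCongr (ρ'.subtypePerm hiff) with hρdef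
    have hρ : ∀ u, ρ' (Fin.castLE h u) = Fin.castLE h (ρ u) := by
      intro u
      rw [hρdef]
      ext
      simp
    refine ⟨ρ, fun u => memG_of_mem u (ρ u) (by rw [← hρ u]; exact hρ' _), ?_⟩
    rw [← hp, sum_pad_eq h wb wb' hb hb0 ρ ρ' hρ, sum_pad_eq h wa wa' ha ha0 ρ ρ' hρ]
  · -- extension by the identity
    rintro ⟨ρ, hρG, hp⟩
    set ρ' : Perm (Fin N') := ρ.extendDomain (Fin.castLEquiv h) with hρ'def
    have hρ : ∀ u, ρ' (Fin.castLE h u) = Fin.castLE h (ρ u) := by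
      intro u
      rw [hρ'def]
      simpa using Perm.extendDomain_apply_image ρ (Fin.castLEquiv h) u
    have hfix : ∀ v : Fin N', ¬ (v : ℕ) < N → ρ' v = v := by
      intro v hv
      rw [hρ'def]
      exact Perm.extendDomain_apply_not_subtype ρ (Fin.castLEquiv h) hv
    refine ⟨ρ', fun v => ?_, ?_⟩
    · by_cases hv : (v : ℕ) < N
      · have hvu : v = Fin.castLE h ⟨v, hv⟩ := Fin.ext rfl
        rw [hvu, hρ]
        exact mem_of_memG _ _ (hρG _)
      · rw [hfix v hv]
        exact diag_mem v hv
    · rw [sum_pad_eq h wb wb' hb hb0 ρ ρ' hρ, sum_pad_eq h wa wa' ha ha0 ρ ρ' hρ]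
      exact hp

/-- **`stub_facePad` (padding / monotonicity in `n`)** of the line `parabola-register-face` for
`DivisionGap.ShadowBirkhoff` (item `stmt-ValiantsHypothesis-5069`): a pattern face of `DS_N`
with two weight tables reappears inside `DS_{N'}` for every `N' ≥ N` with exactly the same set of
value pairs `(∑ u, wb u (ρ u), ∑ u, wa u (ρ u))` over the supported permutations.  Witnesses: the
padded pattern `(Fin.castLE h × Fin.castLE h) '' G ∪ {(v, v) : v ≥ N}` and the zero extensions of
`wb`, `wa`; the equality of value sets is `facePad_valueSet_eq`. -/
theorem stub_facePad {N N' : ℕ} (h : N ≤ N') (G : Finset (Fin N × Fin N))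
    (wb wa : Fin N → Fin N → ℝ) :
    ∃ (G' : Finset (Fin N' × Fin N')) (wb' wa' : Fin N' → Fin N' → ℝ),
      {p : ℝ × ℝ | ∃ ρ' : Equiv.Perm (Fin N'), (∀ u, (u, ρ' u) ∈ G') ∧
          (∑ u, wb' u (ρ' u), ∑ u, wa' u (ρ' u)) = p} =
        {p : ℝ × ℝ | ∃ ρ : Equiv.Perm (Fin N), (∀ u, (u, ρ u) ∈ G) ∧
          (∑ u, wb u (ρ u), ∑ u, wa u (ρ u)) = p} :=
  ⟨_, fun v v' => if hv : (v : ℕ) < N ∧ (v' : ℕ) < N then wb ⟨v, hv.1⟩ ⟨v', hv.2⟩ else 0,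
    fun v v' => if hv : (v : ℕ) < N ∧ (v' : ℕ) < N then wa ⟨v, hv.1⟩ ⟨v', hv.2⟩ else 0,
    facePad_valueSet_eq h G wb wa _ _ (pad_castLE h wb) (pad_of_not_lt wb) (pad_castLE h wa)
      (pad_of_not_lt wa)⟩

end Summit.ValiantsHypothesis.ValiantsHypothesis.Theorems.DivisionGapShadowBirkhoff

end
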